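import Literature.Geometry.Lorentzian.CarterLayerBookkeeping
import Mathlib.Analysis.Complex.ExponentialBounds
import HarnessLib

/-!
# Bookkeeping for the threshold-regime kernel constant: every atom is a power of the master variable
(namespace `Literature.Geometry.Lorentzian.Kerr`.)

Pure real-variable inequalities turning the uniform explicit constant of
`CarterThresholdRegimeKernel.thresholdRegime_kernel_le`,

  `K = (25/7)(8A₀/(θ₁M) + √A₀) + ((P_I + 829440·P_I′/(θ₁²ω²M))e)²/|ω| + √A₀/2`,
  `A₀ = 96R²/(θ₁Δ_θω²) + 12R²/θ₁²`, `R = max(7M, √(12Λ)/|ω|, 1/(Mω²))`, `η = θ₁/(100M)`,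
  `Φ = ω² + 6Λ/M²`, `B = (Φ/η²)¹⁶·exp(2η·50M²/(θ₁M/2))·(η²(2 + 2|ω|R)² + 2ω²)`,
  `P_I² = (2 + 2|ω|R)² + B/η²`, `P_I′² = 2ω² + B`,

into a monomial `c_K·Y^N` of any `Y ≥ 1` dominating the atoms (`|ω|^{±1}, Λ, M^{±1}, (M²)⁻¹, θ₁⁻¹ ≤ Y`,
and for `A₀` also `θ⁻¹ ≤ Y`, `(r₊ − r₋)⁻¹ ≤ Y³` with `Δ_θ ≥ θ(r₊ − r₋)²`):

* `expArg_eq_two` — the transport exponent is `2` (`2η·50M²/(θ₁M/2) = 2`; then `e² ≤ 8` inline);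
* `farConstant_B_le_pow` — `B ≤ c_B·Y^105`, `c_B = 8·678·(7·10⁴)¹⁶`;
* `farEnvelope_sq_le_pow` — `P_I² ≤ (676 + 10⁴c_B)·Y^109` and `P_I′² ≤ (2 + c_B)·Y^105`;
* `collarConstant_le_pow` — `A₀ ≤ 15552·Y^16`;
* `thresholdKernelConstant_le_pow` — `K ≤ c_K·Y^116` with an explicit absolute `c_K`.

The same lemmas serve the κ-free master variable (depth condition) and the κ-dependent one (kernel
constant) of the threshold cone kernel bound (near-extremal Kerr programme, crux `KappaExplicitWaveDecay`).

## References
* M. Dafermos, I. Rodnianski, Y. Shlapentokh-Rothman, arXiv:1402.7034, §6; key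
  `DafermosRodnianskiShlapentokhrothman2014`. Folklore arithmetic.
-/

noncomputable section

namespace Literature.Geometry.Lorentzian

namespace Kerr

section Bookkeeping

variable {Y ω M θ θ₁ Λ : ℝ}

/-- The transport exponent of the far envelope restarted at `ζ = θ₁M/2` with `η = θ₁/(100M)` is `2`.
[folklore] -/
theorem expArg_eq_two (hM : 0 < M) (hθ₁ : 0 < θ₁) :
    2 * (θ₁ / (100 * M)) * (50 * M ^ 2 / (θ₁ * M / 2)) = 2 := by
  field_simp
  ring

/-- Atom consequences shared below: `ω² ≤ Y²`, `η⁻¹ ≤ 100Y²`, `η² ≤ Y` (`η = θ₁/(100M)`, `θ₁ ≤ 1`).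
[folklore] -/
private theorem eta_atoms (hY : 1 ≤ Y) (hM : 0 < M) (hθ₁ : 0 < θ₁) (hθ₁1 : θ₁ ≤ 1)
    (hM2i : (M ^ 2)⁻¹ ≤ Y) (hθ₁i : θ₁⁻¹ ≤ Y) (hMY : M ≤ Y) :
    (θ₁ / (100 * M))⁻¹ ≤ 100 * Y ^ 2 ∧ (θ₁ / (100 * M)) ^ 2 ≤ Y := by
  have hY0 : 0 < Y := by linarith
  constructor
  · rw [inv_div]
    calc 100 * M / θ₁ = 100 * (M * θ₁⁻¹) := by rw [div_eq_mul_inv]; ring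
      _ ≤ 100 * (Y * Y) := by gcongr
      _ = 100 * Y ^ 2 := by ring
  · have h1 : θ₁ / (100 * M) ≤ M⁻¹ := by
      rw [div_le_iff₀ (by positivity)]
      have : M⁻¹ * (100 * M) = 100 := by field_simp
      rw [this]; linarith
    have h0 : 0 ≤ θ₁ / (100 * M) := by positivity
    calc (θ₁ / (100 * M)) ^ 2 ≤ (M⁻¹) ^ 2 := pow_le_pow_left₀ h0 h1 2
      _ = (M ^ 2)⁻¹ := by rw [inv_pow]
      _ ≤ Y := hM2i

/-- **`B ≤ c_B Y^105`**, `c_B = 8·678·(7·10⁴)¹⁶`. [folklore] -/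
theorem farConstant_B_le_pow (hY : 1 ≤ Y) (hM : 0 < M) (hθ₁ : 0 < θ₁) (hθ₁1 : θ₁ ≤ 1) (hω : |ω| ≤ Y)
    (hΛ : Λ ≤ Y) (hΛ0 : 0 ≤ Λ) (hM2i : (M ^ 2)⁻¹ ≤ Y) (hθ₁i : θ₁⁻¹ ≤ Y) (hMY : M ≤ Y)
    {R : ℝ} (hR0 : 0 ≤ R) (hR : R ≤ 12 * Y ^ 3) :
    ((ω ^ 2 + 6 * Λ / M ^ 2) / (θ₁ / (100 * M)) ^ 2) ^ 16 *
        Real.exp (2 * (θ₁ / (100 * M)) * (50 * M ^ 2 / (θ₁ * M / 2))) *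
        ((θ₁ / (100 * M)) ^ 2 * (2 + 2 * |ω| * R) ^ 2 + 2 * ω ^ 2) ≤
      8 * 678 * (7e4) ^ 16 * Y ^ 105 := by
  have hY0 : 0 < Y := by linarith
  obtain ⟨hηi, hη2⟩ := eta_atoms hY hM hθ₁ hθ₁1 hM2i hθ₁i hMY
  set η := θ₁ / (100 * M) with hη
  have hη0 : 0 < η := by positivity
  have hω2 : ω ^ 2 ≤ Y ^ 2 := by rw [← sq_abs]; exact pow_le_pow_left₀ (abs_nonneg _) hω 2
  -- `Φ ≤ 7Y²`
  have hΦ : ω ^ 2 + 6 * Λ / M ^ 2 ≤ 7 * Y ^ 2 := by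
    have h1 : 6 * Λ / M ^ 2 ≤ 6 * Y ^ 2 := by
      rw [div_eq_mul_inv]
      calc 6 * Λ * (M ^ 2)⁻¹ ≤ 6 * Y * Y := mul_le_mul (by linarith) hM2i (by positivity) (by positivity)
        _ = 6 * Y ^ 2 := by ring
    linarith
  have hΦ0 : 0 ≤ ω ^ 2 + 6 * Λ / M ^ 2 := by positivity
  -- `(Φ/η²)^16 ≤ (7e4)^16 Y^96`
  have hΦη : (ω ^ 2 + 6 * Λ / M ^ 2) / η ^ 2 ≤ 7e4 * Y ^ 6 := by
    rw [div_eq_mul_inv, ← inv_pow]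
    calc (ω ^ 2 + 6 * Λ / M ^ 2) * η⁻¹ ^ 2 ≤ 7 * Y ^ 2 * (100 * Y ^ 2) ^ 2 :=
          mul_le_mul hΦ (pow_le_pow_left₀ (by positivity) hηi 2) (by positivity) (by positivity)
      _ = 7e4 * Y ^ 6 := by ring
  have h16 : ((ω ^ 2 + 6 * Λ / M ^ 2) / η ^ 2) ^ 16 ≤ (7e4) ^ 16 * Y ^ 96 := by
    calc _ ≤ (7e4 * Y ^ 6) ^ 16 := pow_le_pow_left₀ (by positivity) hΦη 16
      _ = (7e4) ^ 16 * Y ^ 96 := by ring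
  -- the exponential is `e² ≤ 8`
  have hexp : Real.exp (2 * η * (50 * M ^ 2 / (θ₁ * M / 2))) ≤ 8 := by
    rw [hη, expArg_eq_two hM hθ₁, show (2:ℝ) = (2:ℕ) * 1 by norm_num, Real.exp_nat_mul]
    have h := Real.exp_one_lt_d9
    nlinarith [Real.exp_pos 1]
  -- the last factor `≤ 678 Y⁹`
  have hPf : 2 + 2 * |ω| * R ≤ 26 * Y ^ 4 := by
    have h1 : |ω| * R ≤ Y * (12 * Y ^ 3) := mul_le_mul hω hR hR0 hY0.le
    have h4 : (1 : ℝ) ≤ Y ^ 4 := one_le_pow₀ hY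
    nlinarith [h1, h4]
  have hlast : η ^ 2 * (2 + 2 * |ω| * R) ^ 2 + 2 * ω ^ 2 ≤ 678 * Y ^ 9 := by
    have h1 : (2 + 2 * |ω| * R) ^ 2 ≤ (26 * Y ^ 4) ^ 2 := pow_le_pow_left₀ (by positivity) hPf 2
    have h2 : η ^ 2 * (2 + 2 * |ω| * R) ^ 2 ≤ Y * (26 * Y ^ 4) ^ 2 :=
      mul_le_mul hη2 h1 (by positivity) hY0.le
    have h3 : Y ^ 2 ≤ Y ^ 9 := pow_le_pow_right₀ hY (by norm_num)
    have e : Y * (26 * Y ^ 4) ^ 2 = 676 * Y ^ 9 := by ring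
    linarith [h2, hω2, h3, e]
  calc _ ≤ ((7e4) ^ 16 * Y ^ 96) * 8 * (678 * Y ^ 9) := by
        apply mul_le_mul (mul_le_mul h16 hexp (Real.exp_pos _).le (by positivity)) hlast
          (by positivity) (by positivity)
    _ = 8 * 678 * (7e4) ^ 16 * Y ^ 105 := by ring

/-- **Far-envelope squares**: with `B` bounded as in `farConstant_B_le_pow` (`B ≤ c_B Y^105`),
`(2 + 2|ω|R)² + B/η² ≤ (676 + 10⁴c_B)Y^109` and `2ω² + B ≤ (2 + c_B)Y^105`. [folklore] -/
theorem farEnvelope_sq_le_pow (hY : 1 ≤ Y) (hM : 0 < M) (hθ₁ : 0 < θ₁) (hθ₁1 : θ₁ ≤ 1) (hω : |ω| ≤ Y)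
    (hM2i : (M ^ 2)⁻¹ ≤ Y) (hθ₁i : θ₁⁻¹ ≤ Y) (hMY : M ≤ Y) {R B : ℝ} (hR0 : 0 ≤ R) (hR : R ≤ 12 * Y ^ 3)
    (hB : B ≤ 8 * 678 * (7e4) ^ 16 * Y ^ 105) :
    (2 + 2 * |ω| * R) ^ 2 + B / (θ₁ / (100 * M)) ^ 2 ≤ (676 + 1e4 * (8 * 678 * (7e4) ^ 16)) * Y ^ 109 ∧
      2 * ω ^ 2 + B ≤ (2 + 8 * 678 * (7e4) ^ 16) * Y ^ 105 := by
  have hY0 : 0 < Y := by linarith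
  obtain ⟨hηi, -⟩ := eta_atoms hY hM hθ₁ hθ₁1 hM2i hθ₁i hMY
  set cB : ℝ := 8 * 678 * (7e4) ^ 16 with hcB
  have hω2 : ω ^ 2 ≤ Y ^ 2 := by rw [← sq_abs]; exact pow_le_pow_left₀ (abs_nonneg _) hω 2
  have hPf : 2 + 2 * |ω| * R ≤ 26 * Y ^ 4 := by
    have h1 : |ω| * R ≤ Y * (12 * Y ^ 3) := mul_le_mul hω hR hR0 hY0.le
    have h4 : (1 : ℝ) ≤ Y ^ 4 := one_le_pow₀ hY
    nlinarith [h1, h4]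
  have hPf2 : (2 + 2 * |ω| * R) ^ 2 ≤ 676 * Y ^ 8 := by
    calc _ ≤ (26 * Y ^ 4) ^ 2 := pow_le_pow_left₀ (by positivity) hPf 2
      _ = 676 * Y ^ 8 := by ring
  constructor
  · have h1 : B / (θ₁ / (100 * M)) ^ 2 ≤ cB * Y ^ 105 * (1e4 * Y ^ 4) := by
      rw [div_eq_mul_inv, ← inv_pow]
      refine mul_le_mul hB ?_ (by positivity) (by positivity)
      calc (θ₁ / (100 * M))⁻¹ ^ 2 ≤ (100 * Y ^ 2) ^ 2 := pow_le_pow_left₀ (by positivity) hηi 2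
        _ = 1e4 * Y ^ 4 := by ring
    have h2 : Y ^ 8 ≤ Y ^ 109 := pow_le_pow_right₀ hY (by norm_num)
    have e : cB * Y ^ 105 * (1e4 * Y ^ 4) = 1e4 * cB * Y ^ 109 := by ring
    nlinarith [h1, h2, hPf2, e]
  · have h2 : Y ^ 2 ≤ Y ^ 105 := pow_le_pow_right₀ hY (by norm_num)
    nlinarith [hB, hω2, h2]

/-- **The collar constant**: `A₀ = 96R²/(θ₁Δ_θω²) + 12R²/θ₁² ≤ 15552·Y^16` when `R ≤ 12Y³`,
`θ₁⁻¹, θ⁻¹, |ω|⁻¹ ≤ Y`, `(r₊ − r₋)⁻¹ ≤ Y³` and `Δ_θ ≥ θ(r₊ − r₋)² > 0`. [folklore] -/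
theorem collarConstant_le_pow (hY : 1 ≤ Y) (hθ : 0 < θ) (hθ₁ : 0 < θ₁) (hω0 : 0 < |ω|)
    (hωi : |ω|⁻¹ ≤ Y) (hθi : θ⁻¹ ≤ Y) (hθ₁i : θ₁⁻¹ ≤ Y) {R d Δθ : ℝ} (hR0 : 0 ≤ R) (hR : R ≤ 12 * Y ^ 3)
    (hd : 0 < d) (hdi : d⁻¹ ≤ Y ^ 3) (hΔ : θ * d ^ 2 ≤ Δθ) :
    96 * R ^ 2 / (θ₁ * Δθ * ω ^ 2) + 12 * R ^ 2 / θ₁ ^ 2 ≤ 15552 * Y ^ 16 := by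
  have hY0 : 0 < Y := by linarith
  have hΔ0 : 0 < Δθ := lt_of_lt_of_le (by positivity) hΔ
  have hR2 : R ^ 2 ≤ 144 * Y ^ 6 := by
    calc R ^ 2 ≤ (12 * Y ^ 3) ^ 2 := pow_le_pow_left₀ hR0 hR 2
      _ = 144 * Y ^ 6 := by ring
  have hΔi : Δθ⁻¹ ≤ Y ^ 7 := by
    calc Δθ⁻¹ ≤ (θ * d ^ 2)⁻¹ := by rw [inv_le_inv₀ hΔ0 (by positivity)]; exact hΔ
      _ = θ⁻¹ * (d⁻¹) ^ 2 := by rw [mul_inv, inv_pow]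
      _ ≤ Y * (Y ^ 3) ^ 2 := mul_le_mul hθi (pow_le_pow_left₀ (by positivity) hdi 2) (by positivity) hY0.le
      _ = Y ^ 7 := by ring
  have hωi2 : (ω ^ 2)⁻¹ ≤ Y ^ 2 := by
    rw [← sq_abs, ← inv_pow]; exact pow_le_pow_left₀ (by positivity) hωi 2
  have h1 : 96 * R ^ 2 / (θ₁ * Δθ * ω ^ 2) ≤ 13824 * Y ^ 16 := by
    rw [div_eq_mul_inv, mul_inv, mul_inv]
    calc 96 * R ^ 2 * (θ₁⁻¹ * Δθ⁻¹ * (ω ^ 2)⁻¹) ≤ 96 * (144 * Y ^ 6) * (Y * Y ^ 7 * Y ^ 2) := by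
          apply mul_le_mul (by linarith) _ (by positivity) (by positivity)
          exact mul_le_mul (mul_le_mul hθ₁i hΔi (by positivity) hY0.le) hωi2 (by positivity)
            (by positivity)
      _ = 13824 * Y ^ 16 := by ring
  have h2 : 12 * R ^ 2 / θ₁ ^ 2 ≤ 1728 * Y ^ 16 := by
    rw [div_eq_mul_inv, ← inv_pow]
    have h3 : Y ^ 8 ≤ Y ^ 16 := pow_le_pow_right₀ hY (by norm_num)
    calc 12 * R ^ 2 * θ₁⁻¹ ^ 2 ≤ 12 * (144 * Y ^ 6) * Y ^ 2 :=
          mul_le_mul (by linarith) (pow_le_pow_left₀ (by positivity) hθ₁i 2) (by positivity)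
            (by positivity)
      _ = 1728 * Y ^ 8 := by ring
      _ ≤ 1728 * Y ^ 16 := by linarith
  linarith

/-- **The threshold kernel constant is a monomial.** With
`P_I² ≤ (676 + 10⁴c_B)Y^109`, `P_I′² ≤ (2 + c_B)Y^105`, `0 ≤ A₀ ≤ 15552Y^16`, `|ω|⁻¹, M⁻¹, θ₁⁻¹ ≤ Y`,
`Y ≥ 1`: `K ≤ c_K·Y^116` for the constant `K` of the module docstring. [folklore] -/
theorem thresholdKernelConstant_le_pow (hY : 1 ≤ Y) (hω0 : 0 < |ω|) (hωi : |ω|⁻¹ ≤ Y) (hM : 0 < M)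
    (hMi : M⁻¹ ≤ Y) (hθ₁ : 0 < θ₁) (hθ₁i : θ₁⁻¹ ≤ Y) {PI PI' A₀ : ℝ}
    (hPI : PI ^ 2 ≤ (676 + 1e4 * (8 * 678 * (7e4) ^ 16)) * Y ^ 109)
    (hPI' : PI' ^ 2 ≤ (2 + 8 * 678 * (7e4) ^ 16) * Y ^ 105) (hA₀0 : 0 ≤ A₀) (hA₀ : A₀ ≤ 15552 * Y ^ 16) :
    25 / 7 * (8 * A₀ / (θ₁ * M) + Real.sqrt A₀) +
        ((PI + 829440 / (θ₁ ^ 2 * ω ^ 2 * M) * PI') * Real.exp 1) ^ 2 / |ω| + Real.sqrt A₀ / 2 ≤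
      (5e5 + 8 * (2 * (676 + 1e4 * (8 * 678 * (7e4) ^ 16)) +
        2 * 829440 ^ 2 * (2 + 8 * 678 * (7e4) ^ 16)) + 7777) * Y ^ 116 := by
  have hY0 : 0 < Y := by linarith
  set cB : ℝ := 8 * 678 * (7e4) ^ 16 with hcB
  set cP : ℝ := 676 + 1e4 * cB with hcP
  set cP' : ℝ := 2 + cB with hcP'
  have hcB0 : 0 ≤ cB := by positivity
  -- `√A₀ ≤ A₀ + 1 ≤ 15553 Y^16`
  have hY16 : (1 : ℝ) ≤ Y ^ 16 := one_le_pow₀ hY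
  have hsq : Real.sqrt A₀ ≤ 15553 * Y ^ 16 := by
    have h1 : Real.sqrt A₀ ≤ A₀ + 1 := by
      rw [Real.sqrt_le_left (by positivity)]; nlinarith
    linarith
  -- first summand
  have h1 : 25 / 7 * (8 * A₀ / (θ₁ * M) + Real.sqrt A₀) ≤ 5e5 * Y ^ 18 := by
    have h2 : 8 * A₀ / (θ₁ * M) ≤ 124416 * Y ^ 18 := by
      rw [div_eq_mul_inv, mul_inv]
      calc 8 * A₀ * (θ₁⁻¹ * M⁻¹) ≤ 8 * (15552 * Y ^ 16) * (Y * Y) := by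
            apply mul_le_mul (by linarith) (mul_le_mul hθ₁i hMi (by positivity) hY0.le) (by positivity)
              (by positivity)
        _ = 124416 * Y ^ 18 := by ring
    have h3 : Y ^ 16 ≤ Y ^ 18 := pow_le_pow_right₀ hY (by norm_num)
    nlinarith [h2, hsq, h3]
  -- second summand
  have h2 : ((PI + 829440 / (θ₁ ^ 2 * ω ^ 2 * M) * PI') * Real.exp 1) ^ 2 / |ω| ≤
      8 * (2 * cP + 2 * 829440 ^ 2 * cP') * Y ^ 116 := by
    set c := 829440 / (θ₁ ^ 2 * ω ^ 2 * M) with hc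
    have hc0 : 0 ≤ c := by positivity
    have hcY : c ≤ 829440 * Y ^ 5 := by
      have e : c = 829440 * (θ₁⁻¹ ^ 2 * |ω|⁻¹ ^ 2 * M⁻¹) := by
        rw [hc, inv_pow, inv_pow, sq_abs]; field_simp
      rw [e]
      calc 829440 * (θ₁⁻¹ ^ 2 * |ω|⁻¹ ^ 2 * M⁻¹) ≤ 829440 * (Y ^ 2 * Y ^ 2 * Y) := by
            apply mul_le_mul_of_nonneg_left _ (by norm_num)
            exact mul_le_mul (mul_le_mul (pow_le_pow_left₀ (by positivity) hθ₁i 2)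
              (pow_le_pow_left₀ (by positivity) hωi 2) (by positivity) (by positivity)) hMi
              (by positivity) (by positivity)
        _ = 829440 * Y ^ 5 := by ring
    -- `(P_I + c P_I′)² ≤ 2P_I² + 2c²P_I′² ≤ (2cP + 2·829440²cP′) Y^115`
    have hsum : (PI + c * PI') ^ 2 ≤ (2 * cP + 2 * 829440 ^ 2 * cP') * Y ^ 115 := by
      have e1 : (PI + c * PI') ^ 2 ≤ 2 * PI ^ 2 + 2 * (c ^ 2 * PI' ^ 2) := by
        nlinarith [sq_nonneg (PI - c * PI')]
      have e2 : c ^ 2 * PI' ^ 2 ≤ (829440 * Y ^ 5) ^ 2 * (cP' * Y ^ 105) :=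
        mul_le_mul (pow_le_pow_left₀ hc0 hcY 2) hPI' (by positivity) (by positivity)
      have e3 : Y ^ 109 ≤ Y ^ 115 := pow_le_pow_right₀ hY (by norm_num)
      have e4 : (829440 * Y ^ 5) ^ 2 * (cP' * Y ^ 105) = 829440 ^ 2 * cP' * Y ^ 115 := by ring
      have hcP0 : 0 ≤ cP := by positivity
      nlinarith [e1, e2, e3, e4, hPI, mul_le_mul_of_nonneg_left e3 hcP0]
    have hexp : Real.exp 1 ^ 2 ≤ 8 := by
      have h := Real.exp_one_lt_d9
      nlinarith [Real.exp_pos 1]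
    have h3 : ((PI + c * PI') * Real.exp 1) ^ 2 ≤ (2 * cP + 2 * 829440 ^ 2 * cP') * Y ^ 115 * 8 := by
      rw [mul_pow]
      exact mul_le_mul hsum hexp (by positivity) (by positivity)
    rw [div_eq_mul_inv]
    calc _ ≤ (2 * cP + 2 * 829440 ^ 2 * cP') * Y ^ 115 * 8 * Y :=
          mul_le_mul h3 hωi (by positivity) (by positivity)
      _ = 8 * (2 * cP + 2 * 829440 ^ 2 * cP') * Y ^ 116 := by ring
  -- third summand and assembly
  have h3 : Real.sqrt A₀ / 2 ≤ 7777 * Y ^ 116 := by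
    have : Y ^ 16 ≤ Y ^ 116 := pow_le_pow_right₀ hY (by norm_num)
    nlinarith [hsq, this]
  have h4 : 5e5 * Y ^ 18 ≤ 5e5 * Y ^ 116 := by
    have : Y ^ 18 ≤ Y ^ 116 := pow_le_pow_right₀ hY (by norm_num)
    linarith
  have e : (5e5 + 8 * (2 * cP + 2 * 829440 ^ 2 * cP') + 7777) * Y ^ 116 =
      5e5 * Y ^ 116 + 8 * (2 * cP + 2 * 829440 ^ 2 * cP') * Y ^ 116 + 7777 * Y ^ 116 := by ring
  rw [e]
  linarith [h1, h2, h3, h4]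

end Bookkeeping

end Kerr

end Literature.Geometry.Lorentzian

end
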